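import Mathlib
import Summits.ValiantsHypothesis.ValiantsHypothesis.Theses.ForgivenCollisions

/-!
# Route ForgivenCollisions — support `CounterRepresentative` (stmt-ValiantsHypothesis-11570)

THE PERMANENT IS A MOD-`n` COUNTER AWAY FROM A PRODUCT OF LINEAR FORMS.  With `J_2(n)` the
collision ideal spanned by the monomials having a tripled row, a tripled column, or at least two
doubled lines, the 0/1 polynomial
`f = ∑_{j : [n] → [n], Σ_i j(i) ≡ Σ_c c (mod n)} ∏_i x_{i, j(i)}`
satisfies `f - per_n ∈ J_2(n)`
(`Summit.ValiantsHypothesis.ValiantsHypothesis.Theses.ForgivenCollisions.CounterRepresentative`).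

## Proof

* `sum_filter_sub_perPoly_mem_span` (the reusable frame, also the shape of the syndrome lemma):
  for any predicate `p` on maps `j : [n] → [n]` holding at every permutation, the filtered sum of
  the rook monomials `∏_i x_{i, j(i)}` minus `per_n` is the sum over the NON-bijective `j` with
  `p j` (the bijective part is `per_n` after reindexing `σ ↦ σ⁻¹`), so it lies in the span of any
  set of monomials containing the exponents `∑_i e_{(i, j i)}` of those `j`.
* `exists_doubled_and_empty_col` (the counter): a non-injective `j` all of whose column fibres
  have size `≤ 2`, at most one of size `2`, has exactly one doubled column `k` and one empty
  column `k'`, whence `Σ_i j(i) + k' = Σ_c c + k`; as `0 < |k - k'| < n` this is incompatible with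
  `Σ_i j(i) ≡ Σ_c c (mod n)` (`sum_single_mem_bad_two`), so every surviving non-bijective `j` has a
  `Bad_2` exponent.

## References

* D. G. Glynn, *The permanent of a square matrix*, European J. Combin. 31 (2010) 1887–1891
  (the signed formula whose orthogonal-array version this generalises). [Glynn2010]
* K. Pratt, *Waring rank, parameterized and exact algorithms*, FOCS 2019, Thm 53 (group-algebra
  device killing all squares). [Pratt2019]
-/

noncomputable section

-- `Summit.ValiantsHypothesis.ValiantsHypothesis.…` is the tree's mandated single-conjunct layout
-- (Sub = Summit), so the duplicated namespace component is intended.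
set_option linter.dupNamespace false

namespace Summit.ValiantsHypothesis.ValiantsHypothesis.Theorems.ForgivenCollisionsCounterRepresentative

open MvPolynomial Finset Literature.Computability.AlgebraicComplexity

/-- **Frame.** If `p` holds at every permutation, then
`∑_{j : p j} ∏_i X_{i, j i} - per_n` lies in the span of the monomials of any set `S` of exponents
containing `∑_i e_{(i, j i)}` for every non-bijective `j` with `p j` (the bijective part of the sum
is `per_n`, reindexed by `σ ↦ σ⁻¹`). [folklore] -/
theorem sum_filter_sub_perPoly_mem_span {n : ℕ} (p : (Fin n → Fin n) → Prop) [DecidablePred p]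
    (S : Set (Fin n × Fin n →₀ ℕ)) (hperm : ∀ σ : Equiv.Perm (Fin n), p σ)
    (hbad : ∀ j : Fin n → Fin n, p j → ¬ Function.Bijective j →
      (∑ i, Finsupp.single (i, j i) 1) ∈ S) :
    (∑ j ∈ (univ : Finset (Fin n → Fin n)).filter p,
        ∏ i : Fin n, (X (i, j i) : MvPolynomial (Fin n × Fin n) ℂ)) - perPoly (Fin n) ℂ ∈
      Ideal.span ((fun d : Fin n × Fin n →₀ ℕ => monomial d (1 : ℂ)) '' S) := by
  classical
  have hsplit := Finset.sum_filter_add_sum_filter_not ((univ : Finset (Fin n → Fin n)).filter p)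
    Function.Bijective (fun j : Fin n → Fin n => ∏ i : Fin n, (X (i, j i) : MvPolynomial _ ℂ))
  have hA : (∑ j ∈ ((univ : Finset (Fin n → Fin n)).filter p).filter Function.Bijective,
      ∏ i : Fin n, (X (i, j i) : MvPolynomial (Fin n × Fin n) ℂ)) = perPoly (Fin n) ℂ := by
    unfold perPoly Matrix.permanent
    symm
    refine Finset.sum_bij (fun σ _ => ⇑σ.symm) ?_ ?_ ?_ ?_
    · intro σ _
      simp only [Finset.mem_filter, Finset.mem_univ, true_and]
      exact ⟨hperm σ.symm, σ.symm.bijective⟩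
    · intro σ _ τ _ h
      have h' : σ.symm = τ.symm := Equiv.ext (congrFun h)
      simpa using congrArg Equiv.symm h'
    · intro j hj
      simp only [Finset.mem_filter, Finset.mem_univ, true_and] at hj
      exact ⟨(Equiv.ofBijective j hj.2).symm, mem_univ _, by simp⟩
    · intro σ _
      rw [← Equiv.prod_comp σ (fun c => (X (c, σ.symm c) : MvPolynomial (Fin n × Fin n) ℂ))]
      simp [Matrix.mvPolynomialX_apply]
  rw [← hsplit, hA, add_sub_cancel_left]
  refine Ideal.sum_mem _ fun j hj => ?_
  simp only [Finset.mem_filter, Finset.mem_univ, true_and] at hj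
  have hmono : (∏ i : Fin n, (X (i, j i) : MvPolynomial (Fin n × Fin n) ℂ)) =
      monomial (∑ i, Finsupp.single (i, j i) 1) 1 := by
    rw [monomial_sum_one]
    rfl
  rw [hmono]
  exact Ideal.subset_span ⟨_, hbad j hj.1 hj.2, rfl⟩

/-- The column count of the rook exponent `∑_i e_{(i, j i)}` at column `c` is the size of the
fibre `j⁻¹(c)`. [folklore] -/
theorem colCount_sum_single {n : ℕ} (j : Fin n → Fin n) (c : Fin n) :
    colCount (∑ i, Finsupp.single (i, j i) 1) c = ((univ : Finset (Fin n)).filter fun i => j i = c).card := by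
  classical
  simp only [colCount, Finsupp.coe_finsetSum, Finset.sum_apply, Finsupp.single_apply,
    Prod.mk.injEq]
  rw [Finset.card_eq_sum_ones, Finset.sum_filter]
  refine Finset.sum_congr rfl fun r _ => ?_
  rw [Finset.sum_eq_single r]
  · simp
  · intro i _ hir
    simp [hir]
  · simp

/-- The row count of the rook exponent `∑_i e_{(i, j i)}` is `1` everywhere. [folklore] -/
theorem rowCount_sum_single {n : ℕ} (j : Fin n → Fin n) (r : Fin n) :
    rowCount (∑ i, Finsupp.single (i, j i) 1) r = 1 := by
  classical
  simp only [rowCount, Finsupp.coe_finsetSum, Finset.sum_apply, Finsupp.single_apply,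
    Prod.mk.injEq]
  rw [Finset.sum_comm, Finset.sum_eq_single r]
  · simp
  · intro i _ hir
    simp [hir]
  · simp

/-- **The counter.** A non-injective `j : [n] → [n]` whose column fibres have size `≤ 2`, at most
one of them of size `≥ 2`, has one doubled column `k` and one empty column `k' ≠ k`, all other
fibres being singletons; consequently `Σ_i j(i) + k' = Σ_c c + k`. [folklore] -/
theorem exists_doubled_and_empty_col {n : ℕ} (j : Fin n → Fin n) (hj : ¬ Function.Injective j)
    (h3 : ∀ c, ((univ : Finset (Fin n)).filter fun i => j i = c).card ≤ 2)
    (h2 : ((univ : Finset (Fin n)).filter fun c =>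
      2 ≤ ((univ : Finset (Fin n)).filter fun i => j i = c).card).card ≤ 1) :
    ∃ k k' : Fin n, k ≠ k' ∧ (∑ i, (j i : ℕ)) + k' = (∑ c : Fin n, (c : ℕ)) + k := by
  classical
  set m : Fin n → ℕ := fun c => ((univ : Finset (Fin n)).filter fun i => j i = c).card with hm
  have h3' : ∀ c, m c ≤ 2 := h3
  have h2' : ((univ : Finset (Fin n)).filter fun c => 2 ≤ m c).card ≤ 1 := h2
  -- the doubled column
  obtain ⟨k, hk2⟩ : ∃ k, 2 ≤ m k := by
    obtain ⟨a, b, hab, hne⟩ := Function.not_injective_iff.1 hj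
    exact ⟨j a, Finset.one_lt_card.2 ⟨a, by simp, b, by simp [hab], hne⟩⟩
  have hmk : m k = 2 := le_antisymm (h3' k) hk2
  have hle1 : ∀ c, c ≠ k → m c ≤ 1 := by
    intro c hc
    by_contra h
    have h' : 2 ≤ m c := by omega
    have : 1 < ((univ : Finset (Fin n)).filter fun c => 2 ≤ m c).card :=
      Finset.one_lt_card.2 ⟨k, Finset.mem_filter.2 ⟨mem_univ _, hk2⟩, c,
        Finset.mem_filter.2 ⟨mem_univ _, h'⟩, fun h => hc h.symm⟩
    omega
  -- the fibres partition `[n]`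
  have htot : ∑ c, m c = n := by
    have h := Finset.sum_fiberwise (univ : Finset (Fin n)) j (fun _ => (1 : ℕ))
    simp only [sum_const, smul_eq_mul, mul_one, card_univ, Fintype.card_fin] at h
    exact h
  have hsum_erase : (∑ c ∈ univ.erase k, m c) + 2 = n := by
    rw [← hmk, Finset.sum_erase_add _ _ (mem_univ k), htot]
  -- exactly one empty column
  have hcard0 : ((univ.erase k).filter fun c => m c = 0).card = 1 := by
    have h1 : ∑ c ∈ univ.erase k, (m c + if m c = 0 then 1 else 0) = (univ.erase k).card := by
      rw [Finset.card_eq_sum_ones]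
      refine Finset.sum_congr rfl fun c hc => ?_
      have := hle1 c (Finset.ne_of_mem_erase hc)
      split_ifs with h0 <;> omega
    rw [Finset.sum_add_distrib, Finset.sum_boole, Finset.card_erase_of_mem (mem_univ k), card_univ,
      Fintype.card_fin, Nat.cast_id] at h1
    omega
  obtain ⟨k', hk'⟩ := Finset.card_eq_one.1 hcard0
  have hk'mem : k' ∈ (univ.erase k).filter fun c => m c = 0 := by
    rw [hk']; exact mem_singleton_self _
  simp only [Finset.mem_filter, Finset.mem_erase, Finset.mem_univ, and_true] at hk'mem
  obtain ⟨hk'k, hmk'⟩ := hk'mem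
  have hm1 : ∀ c, c ≠ k → c ≠ k' → m c = 1 := by
    intro c hck hck'
    have h1 := hle1 c hck
    have h0 : m c ≠ 0 := by
      intro h0
      have hc : c ∈ (univ.erase k).filter fun c => m c = 0 := by simp [hck, h0]
      rw [hk', mem_singleton] at hc
      exact hck' hc
    omega
  -- pointwise form of the fibre structure
  have hpt : ∀ c, m c + (if c = k' then 1 else 0) = 1 + (if c = k then 1 else 0) := by
    intro c
    by_cases hck : c = k
    · subst hck
      simp [hmk, Ne.symm hk'k]
    · by_cases hck' : c = k'
      · subst hck'
        simp [hmk', hck]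
      · simp [hck, hck', hm1 c hck hck']
  refine ⟨k, k', fun h => hk'k h.symm, ?_⟩
  have hfib : ∑ i, (j i : ℕ) = ∑ c, m c * (c : ℕ) := by
    rw [← Finset.sum_fiberwise' univ j (fun c : Fin n => (c : ℕ))]
    refine Finset.sum_congr rfl fun c _ => ?_
    rw [Finset.sum_const, smul_eq_mul]
  calc (∑ i, (j i : ℕ)) + k'
      = ∑ c, m c * (c : ℕ) + ∑ c, (if c = k' then 1 else 0) * (c : ℕ) := by
        rw [hfib]; simp
    _ = ∑ c, (m c + if c = k' then 1 else 0) * (c : ℕ) := by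
        rw [← Finset.sum_add_distrib]; simp only [add_mul]
    _ = ∑ c, (1 + if c = k then 1 else 0) * (c : ℕ) := by
        simp only [hpt]
    _ = (∑ c : Fin n, (c : ℕ)) + k := by
        simp [add_mul, Finset.sum_add_distrib]

/-- A non-bijective `j : [n] → [n]` with `Σ_i j(i) ≡ Σ_c c (mod n)` has a `Bad_2` rook exponent:
a tripled column or at least two doubled columns (one doubled column `k` and one empty column
`k'` would shift the sum by `k - k' ≢ 0 (mod n)`). [folklore] -/
theorem sum_single_mem_bad_two {n : ℕ} (j : Fin n → Fin n)
    (hp : (∑ i, (j i : ℕ)) % n = (∑ c : Fin n, (c : ℕ)) % n) (hj : ¬ Function.Bijective j) :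
    (∑ i, Finsupp.single (i, j i) 1) ∈ {d : Fin n × Fin n →₀ ℕ |
      (∃ i : Fin n, 3 ≤ rowCount d i) ∨ (∃ c : Fin n, 3 ≤ colCount d c) ∨
        2 ≤ ((univ : Finset (Fin n)).filter fun i : Fin n => 2 ≤ rowCount d i).card +
          ((univ : Finset (Fin n)).filter fun c : Fin n => 2 ≤ colCount d c).card} := by
  classical
  simp only [Set.mem_setOf_eq, colCount_sum_single, rowCount_sum_single]
  rw [← Finite.injective_iff_bijective] at hj
  by_contra hcon
  push Not at hcon
  obtain ⟨-, h3, h2⟩ := hcon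
  obtain ⟨k, k', hne, hsum⟩ := exists_doubled_and_empty_col j hj
    (fun c => by have := h3 c; omega) (by simpa using h2)
  apply hne
  have hmod : Nat.ModEq n ((∑ c : Fin n, (c : ℕ)) + k) ((∑ c : Fin n, (c : ℕ)) + k') := by
    rw [← hsum]
    exact Nat.ModEq.add_right _ hp
  have hkk := Nat.ModEq.add_left_cancel' _ hmod
  rw [Nat.ModEq, Nat.mod_eq_of_lt k.isLt, Nat.mod_eq_of_lt k'.isLt] at hkk
  exact Fin.ext hkk

/-- **Settles `stmt-ValiantsHypothesis-11570`** (`ForgivenCollisions.CounterRepresentative`, the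
`r = 2`, `G = ℤ/n`, `g(j) = j` rung of the syndrome ladder): the mod-`n` counter polynomial
`∑_{j : Σ_i j(i) ≡ Σ_c c (mod n)} ∏_i x_{i, j(i)}` is congruent to `per_n` modulo the collision
ideal `J_2(n)`. [folklore] -/
theorem CounterRepresentative_proof :
    Summit.ValiantsHypothesis.ValiantsHypothesis.Theses.ForgivenCollisions.CounterRepresentative := by
  unfold Summit.ValiantsHypothesis.ValiantsHypothesis.Theses.ForgivenCollisions.CounterRepresentative
  intro n
  refine sum_filter_sub_perPoly_mem_span _ _ (fun σ => ?_) (fun j hpj hj => ?_)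
  · rw [Equiv.sum_comp σ (fun c : Fin n => (c : ℕ))]
  · exact sum_single_mem_bad_two j hpj hj

end Summit.ValiantsHypothesis.ValiantsHypothesis.Theorems.ForgivenCollisionsCounterRepresentative
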